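import Summits.Ventures.PercRepro.SixFourPLTypesP
import Summits.Ventures.PercRepro.SixFourPLProfileB

/-!
# PercRepro — C-025 at `(6,4)`, §22.12.2 (b): the line profiles of the three kinds of planes (p3, gen 10)

For a normalisation `D : PLData M G` of a plane-line set, `plane_trichotomy` sorts the planes of `M` with a rank-`3`
trace into `P₀`, the planes `Π_y` (`y ∈ ρ ∖ ℓ`) and the planes with trace `{x} ∪ λ` (`x ∈ L`, `λ = P ∩ ρ` a non-class
line trace of `ρ`).  This file treats the first two kinds — the numbers `inc M (P ∩ G) m` of lines of `M` meeting the trace in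
`m ≥ 3` points are the TYPE of `SixFourPLTypesP.lean`:
* `planesR3`, the planes with a rank-`3` trace; `piPlanes`, the planes `Π_y`;
* `subset_line_of_two_le_inter`: a set of rank `≤ 2` sharing two points with a line lies on it;
* `inc_Pi`: the trace `L ∪ λ_y` of `Π_y` has the line `ℓ` (`n + e` points) and, when `|λ_y| ≥ 3`, the line `cl(λ_y)`
  (`|λ_y|` points), and no other line with `≥ 3` points: `inc M (Π_y ∩ G) m = [m = |ℓ ∩ G|] + [m = |λ_y|]`.
`SixFourPLThird.lean` treats the third kind and counts its planes.
-/

namespace PercRepro.SixFour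

open Finset ThmH

variable {α : Type*} [DecidableEq α] {M : Matroid α} [M.Finite] {G : Finset α}

/-- The planes of `M` whose trace on `G` has rank `3`. -/
noncomputable def planesR3 (M : Matroid α) [M.Finite] (G : Finset α) : Finset (Finset α) :=
  (planes M).filter fun P => M.eRk ((P ∩ G : Finset α) : Set α) = 3

/-- Membership in `planesR3`. -/
theorem mem_planesR3 {P : Finset α} : P ∈ planesR3 M G ↔ P ∈ planes M ∧ M.eRk ((P ∩ G : Finset α) : Set α) = 3 :=
  Finset.mem_filter

omit [DecidableEq α] in
/-- The closure of a subset of a plane lies in the plane. -/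
theorem clF_subset_of_subset_plane {P X : Finset α} (hP : P ∈ planes M) (hX : X ⊆ P) : clF M X ⊆ P := by
  rw [← Finset.coe_subset, coe_clF]
  calc M.closure (X : Set α) ⊆ M.closure (P : Set α) := M.closure_subset_closure (Finset.coe_subset.2 hX)
    _ = (P : Set α) := (mem_planes.1 hP).2.1.closure

/-- A set `X` of rank `≤ 2` sharing two points with a line `L′` lies on `L′`, and `L′ = cl(X)`. -/
theorem subset_line_of_two_le_inter (hs : Simple M) {L' X : Finset α} (hL' : L' ∈ lines M) (hX : X ⊆ gr M)
    (hr : M.eRk (X : Set α) ≤ 2) (h2 : 2 ≤ (L' ∩ X).card) : X ⊆ L' ∧ L' = clF M X := by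
  have hr2 : M.eRk ((L' ∩ X : Finset α) : Set α) = 2 :=
    eRk_eq_two_of_subset_line hs hL' Finset.inter_subset_left h2
  have hcl : M.closure ((L' ∩ X : Finset α) : Set α) = (L' : Set α) :=
    closure_eq_of_subset_line hL' Finset.inter_subset_left hr2
  have hXsub : X ⊆ L' := by
    intro z hz
    by_contra hzL
    have hzE : z ∈ M.E := by rw [← coe_gr]; exact_mod_cast hX hz
    have hz' : z ∈ M.E \ M.closure ((L' ∩ X : Finset α) : Set α) := by
      rw [hcl]; exact ⟨hzE, by exact_mod_cast hzL⟩
    have h3 : M.eRk ((insert z (L' ∩ X) : Finset α) : Set α) = 3 := by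
      rw [Finset.coe_insert, Matroid.eRk_insert_eq_add_one hz', hr2]
      rfl
    have hle : M.eRk ((insert z (L' ∩ X) : Finset α) : Set α) ≤ 2 :=
      (M.eRk_mono (Finset.coe_subset.2 (Finset.insert_subset hz Finset.inter_subset_right))).trans hr
    rw [h3] at hle
    exact absurd hle (by decide)
  refine ⟨hXsub, ?_⟩
  have hrX : M.eRk (X : Set α) = 2 :=
    le_antisymm hr (by rw [← hr2]; exact M.eRk_mono (Finset.coe_subset.2 Finset.inter_subset_right))
  apply Finset.coe_injective
  rw [coe_clF]
  exact (closure_eq_of_subset_line hL' hXsub hrX).symm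

namespace PLData

variable {D : PLData M G}

/-! ## The planes `Π_y` -/

/-- The planes `Π_y`, `y ∈ ρ ∖ ℓ`. -/
noncomputable def piPlanes (D : PLData M G) : Finset (Finset α) := (D.ρ \ D.ellF).image D.Pi

/-- Membership in `piPlanes`. -/
theorem mem_piPlanes {P : Finset α} : P ∈ D.piPlanes ↔ ∃ y ∈ D.ρ \ D.ellF, D.Pi y = P := Finset.mem_image

/-- `L` and `λ_y` are disjoint. -/
theorem disjoint_L_lam (y : α) : Disjoint D.L (D.lam y) := by
  rw [Finset.disjoint_left]
  intro z hzL hzl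
  unfold lam ρ at hzl
  unfold L at hzL
  exact (Finset.mem_sdiff.1 hzL).2 (Finset.mem_inter.1 (Finset.mem_inter.1 hzl).2).1

/-- `Π_y ∩ G = L ∪ λ_y`. -/
theorem Pi_trace_eq (hs : Simple M) (hG : G ⊆ gr M) (h2 : 2 ≤ D.L.card) (y : α) :
    D.Pi y ∩ G = D.L ∪ D.lam y := by
  rw [Pi_inter_eq hs hG h2 y, ellF_inter_G_eq hs hG h2]
  have hsub : D.ellF ∩ D.ρ ⊆ D.lam y := fun z hz =>
    mem_lam_of_mem_ellF (Finset.mem_inter.1 hz).1 (Finset.mem_inter.1 hz).2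
  rw [← Finset.union_assoc, Finset.union_comm (D.lam y) D.L, Finset.union_assoc, Finset.union_eq_left.2 hsub]

/-- `|Π_y ∩ G| = n + |λ_y|`. -/
theorem card_Pi_trace (hs : Simple M) (hG : G ⊆ gr M) (h2 : 2 ≤ D.L.card) (y : α) :
    (D.Pi y ∩ G).card = D.L.card + (D.lam y).card := by
  rw [Pi_trace_eq hs hG h2 y, Finset.card_union_of_disjoint (disjoint_L_lam y)]

/-- `Π_y` has a rank-`3` trace (`y ∈ ρ ∖ ℓ`). -/
theorem Pi_mem_planesR3 (hs : Simple M) (hG : G ⊆ gr M) (h2 : 2 ≤ D.L.card) {y : α} (hy : y ∈ D.ρ \ D.ellF) :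
    D.Pi y ∈ planesR3 M G := by
  rw [Finset.mem_sdiff] at hy
  have hyG := D.ρ_subset hy.1
  have hPi := Pi_mem_planes hs hG h2 hyG hy.2
  rw [mem_planesR3]
  refine ⟨hPi.1, le_antisymm (eRk_inter_plane_le_three hPi.1 G) ?_⟩
  rw [← eRk_insert_L_eq_three hs hG h2 hyG hy.2]
  exact M.eRk_mono (Finset.coe_subset.2 (Finset.subset_inter hPi.2 (Finset.insert_subset hyG D.L_subset)))

/-- `piPlanes ⊆ planesR3`. -/
theorem piPlanes_subset (hs : Simple M) (hG : G ⊆ gr M) (h2 : 2 ≤ D.L.card) : D.piPlanes ⊆ planesR3 M G := by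
  intro P hP
  obtain ⟨y, hy, rfl⟩ := mem_piPlanes.1 hP
  exact Pi_mem_planesR3 hs hG h2 hy

/-- `P₀ ∈ planesR3`. -/
theorem P₀_mem_planesR3 : D.P₀ ∈ planesR3 M G := mem_planesR3.2 ⟨D.plane, D.rank_trace⟩

/-- `P₀ ∉ piPlanes`. -/
theorem P₀_notMem_piPlanes (hs : Simple M) (hG : G ⊆ gr M) (h2 : 2 ≤ D.L.card) : D.P₀ ∉ D.piPlanes := by
  intro h
  obtain ⟨y, hy, hPi⟩ := mem_piPlanes.1 h
  rw [Finset.mem_sdiff] at hy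
  exact Pi_ne_P₀ hs hG h2 (D.ρ_subset hy.1) hy.2 hPi

/-- When `|λ_y| ≥ 2`, the line `cl(λ_y)` meets `Π_y ∩ G` exactly in `λ_y`. -/
theorem clF_lam_inter_trace (hs : Simple M) (hG : G ⊆ gr M) (h2 : 2 ≤ D.L.card) {y : α} (hy : y ∈ D.ρ \ D.ellF)
    (hs2 : 2 ≤ (D.lam y).card) : clF M (D.lam y) ∩ (D.Pi y ∩ G) = D.lam y := by
  have hC : D.lam y ∈ D.classes := Finset.mem_image.2 ⟨y, hy, rfl⟩
  obtain ⟨-, htr⟩ := class_line hs hG h2 hC hs2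
  have hlρ : D.lam y ⊆ D.ρ := Finset.inter_subset_right
  have hsubP₀ : clF M (D.lam y) ⊆ D.P₀ := clF_subset_of_subset_plane D.plane (hlρ.trans Finset.inter_subset_left)
  apply Finset.Subset.antisymm
  · intro z hz
    rw [Finset.mem_inter, Finset.mem_inter] at hz
    have hzρ : z ∈ D.ρ := Finset.mem_inter.2 ⟨hsubP₀ hz.1, hz.2.2⟩
    rw [← htr]
    exact Finset.mem_inter.2 ⟨hz.1, hzρ⟩
  · intro z hz
    have hz' : z ∈ clF M (D.lam y) ∩ D.ρ := by rw [htr]; exact hz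
    rw [Finset.mem_inter]
    exact ⟨(Finset.mem_inter.1 hz').1,
      Finset.mem_inter.2 ⟨(Finset.mem_inter.1 hz).1, D.ρ_subset (Finset.mem_inter.1 hz').2⟩⟩

/-- When `|λ_y| ≥ 2`, `cl(λ_y)` is a line. -/
theorem clF_lam_mem_lines (hs : Simple M) (hG : G ⊆ gr M) (h2 : 2 ≤ D.L.card) {y : α} (hy : y ∈ D.ρ \ D.ellF)
    (hs2 : 2 ≤ (D.lam y).card) : clF M (D.lam y) ∈ lines M :=
  (class_line hs hG h2 (Finset.mem_image.2 ⟨y, hy, rfl⟩) hs2).1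

/-- `ℓ ∩ (Π_y ∩ G) = ℓ ∩ G`. -/
theorem ellF_inter_Pi_trace (y : α) : D.ellF ∩ (D.Pi y ∩ G) = D.ellF ∩ G := by
  ext z
  simp only [Finset.mem_inter]
  exact ⟨fun h => ⟨h.1, h.2.2⟩, fun h => ⟨h.1, ellF_subset_Pi y h.1, h.2⟩⟩

/-- A line with `≥ 3` points of `Π_y ∩ G = L ∪ λ_y` is `ℓ`, or it is `cl(λ_y)` and meets the trace in `λ_y`. -/
theorem line_of_three_le_Pi (hs : Simple M) (hG : G ⊆ gr M) (h2 : 2 ≤ D.L.card) {y : α} (hy : y ∈ D.ρ \ D.ellF)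
    {L' : Finset α} (hL' : L' ∈ lines M) (h3 : 3 ≤ (L' ∩ (D.Pi y ∩ G)).card) :
    L' = D.ellF ∨ (L' ∩ (D.Pi y ∩ G) = D.lam y ∧ L' = clF M (D.lam y)) := by
  have h3G : 3 ≤ (L' ∩ G).card :=
    h3.trans (Finset.card_le_card (Finset.inter_subset_inter (Finset.Subset.refl _) Finset.inter_subset_right))
  rcases line_trichotomy hs hG hL' h3G with h | hρ
  · exact Or.inl h
  · right
    -- the trace of `L′` on `Π_y ∩ G` is its trace on `λ_y`
    have hTeq : L' ∩ (D.Pi y ∩ G) = L' ∩ D.lam y := by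
      rw [Pi_trace_eq hs hG h2 y]
      ext z
      simp only [Finset.mem_inter, Finset.mem_union]
      constructor
      · rintro ⟨hzL', hzL | hzl⟩
        · exfalso
          have hzρ : z ∈ D.ρ := hρ (Finset.mem_inter.2 ⟨hzL', D.L_subset hzL⟩)
          unfold ρ at hzρ
          unfold L at hzL
          exact (Finset.mem_sdiff.1 hzL).2 (Finset.mem_inter.1 hzρ).1
        · exact ⟨hzL', hzl⟩
      · rintro ⟨hzL', hzl⟩
        exact ⟨hzL', Or.inr hzl⟩
    rw [hTeq] at h3 ⊢
    rw [Finset.mem_sdiff] at hy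
    have hlG : D.lam y ⊆ gr M := Finset.inter_subset_right.trans (D.ρ_subset.trans hG)
    obtain ⟨hsub, hLc⟩ := subset_line_of_two_le_inter hs hL' hlG (eRk_lam_le_two hs hG h2 (D.ρ_subset hy.1) hy.2)
      (by omega)
    exact ⟨Finset.inter_eq_right.2 hsub, hLc⟩

/-- The lines with `m ≥ 3` points of `Π_y ∩ G` are among `ℓ` and `cl(λ_y)`. -/
theorem filter_lines_Pi (hs : Simple M) (hG : G ⊆ gr M) (h2 : 2 ≤ D.L.card) {y : α} (hy : y ∈ D.ρ \ D.ellF)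
    {m : ℕ} (hm : 3 ≤ m) :
    (lines M).filter (fun L' : Finset α => (L' ∩ (D.Pi y ∩ G)).card = m) =
      (insert D.ellF {clF M (D.lam y)} : Finset (Finset α)).filter
        (fun L' : Finset α => L' ∈ lines M ∧ (L' ∩ (D.Pi y ∩ G)).card = m) := by
  ext L'
  simp only [Finset.mem_filter, Finset.mem_insert, Finset.mem_singleton]
  constructor
  · rintro ⟨hL', hc⟩
    refine ⟨?_, hL', hc⟩
    rcases line_of_three_le_Pi hs hG h2 hy hL' (by omega) with h | ⟨-, h⟩
    · exact Or.inl h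
    · exact Or.inr h
  · rintro ⟨-, hL', hc⟩
    exact ⟨hL', hc⟩

/-- **The line profile of `Π_y` (22.12.2 (b))**: for `m ≥ 3`,
`inc M (Π_y ∩ G) m = [m = |ℓ ∩ G|] + [m = |λ_y|]`. -/
theorem inc_Pi (hs : Simple M) (hG : G ⊆ gr M) (h2 : 2 ≤ D.L.card) {y : α} (hy : y ∈ D.ρ \ D.ellF) {m : ℕ}
    (hm : 3 ≤ m) :
    inc M (D.Pi y ∩ G) m = (if m = (D.ellF ∩ G).card then 1 else 0) + (if m = (D.lam y).card then 1 else 0) := by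
  unfold inc
  rw [filter_lines_Pi hs hG h2 hy hm, Finset.filter_insert, Finset.filter_singleton]
  have hℓ := (D.ellF_mem_lines hs hG h2).1
  -- the condition on `ℓ`
  have hpℓ : (D.ellF ∈ lines M ∧ (D.ellF ∩ (D.Pi y ∩ G)).card = m) ↔ m = (D.ellF ∩ G).card := by
    rw [ellF_inter_Pi_trace y]
    exact ⟨fun h => h.2.symm, fun h => ⟨hℓ, h.symm⟩⟩
  -- the condition on `cl(λ_y)`
  have hpc : (clF M (D.lam y) ∈ lines M ∧ (clF M (D.lam y) ∩ (D.Pi y ∩ G)).card = m) ↔ m = (D.lam y).card := by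
    constructor
    · rintro ⟨hLc, hc⟩
      have hs2 : 2 ≤ (D.lam y).card := by
        by_contra hlt
        push Not at hlt
        have hr1 : M.eRk ((D.lam y : Finset α) : Set α) ≤ 1 := by
          have := M.eRk_le_encard (D.lam y : Set α)
          rw [Set.encard_coe_eq_coe_finsetCard] at this
          exact this.trans (by exact_mod_cast (by omega : (D.lam y).card ≤ 1))
        have hr2 := (mem_lines.1 hLc).2.2
        rw [coe_clF, M.eRk_closure_eq] at hr2
        rw [hr2] at hr1
        exact absurd hr1 (by decide)
      rw [clF_lam_inter_trace hs hG h2 hy hs2] at hc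
      exact hc.symm
    · intro hms
      have hs2 : 2 ≤ (D.lam y).card := by omega
      exact ⟨clF_lam_mem_lines hs hG h2 hy hs2, by rw [clF_lam_inter_trace hs hG h2 hy hs2, hms]⟩
  -- `ℓ ≠ cl(λ_y)` when both conditions hold
  have hne : m = (D.ellF ∩ G).card → m = (D.lam y).card → D.ellF ≠ clF M (D.lam y) := by
    intro _ hms heq
    have hs2 : 2 ≤ (D.lam y).card := by omega
    have h1 := clF_lam_inter_trace hs hG h2 hy hs2
    rw [← heq, ellF_inter_Pi_trace y] at h1
    -- `λ_y = ℓ ∩ G ⊇ L`, but `λ_y ⊆ ρ` is disjoint from `L`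
    obtain ⟨a, ha⟩ := Finset.card_pos.1 (by omega : 0 < D.L.card)
    have haℓ : a ∈ D.ellF ∩ G := Finset.mem_inter.2 ⟨D.L_subset_ellF hs hG h2 ha, D.L_subset ha⟩
    rw [h1] at haℓ
    exact Finset.disjoint_left.1 (disjoint_L_lam y) ha haℓ
  by_cases h1 : m = (D.ellF ∩ G).card
  · rw [if_pos (hpℓ.2 h1), if_pos h1]
    by_cases h2' : m = (D.lam y).card
    · rw [if_pos (hpc.2 h2'), if_pos h2', Finset.card_insert_of_notMem (by
        rw [Finset.mem_singleton]; exact hne h1 h2'), Finset.card_singleton]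
    · rw [if_neg (fun h => h2' (hpc.1 h)), if_neg h2', Finset.insert_empty, Finset.card_singleton]
  · rw [if_neg (fun h => h1 (hpℓ.1 h)), if_neg h1, zero_add]
    by_cases h2' : m = (D.lam y).card
    · rw [if_pos (hpc.2 h2'), if_pos h2', Finset.card_singleton]
    · rw [if_neg (fun h => h2' (hpc.1 h)), if_neg h2', Finset.card_empty]

end PLData

end PercRepro.SixFour
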